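import Summits.QuantumFields.QCD.Theorems.WilsonMobilityGapChiralMobilityGapSketchDefs

/-!
# Crux `ChiralMobilityGap` (stmt-QuantumFields-17497) — line `Sketch` (card `pin-rides-on-lower-clause`):
# the chiral pin rides on clause (iii) — SKELETON v4 (lead prover-line-stmt-QuantumFields-17497-0)

The crux is `MobilityGap` (support stmt-QuantumFields-9150) with the chiral pin `reg.IsChiralAtZero` inserted
(`WilsonMobilityGap.chiralMobilityGap_iff`).  The line: the pin is the small-mass asymptotics of the
constants of clause (iii) LOWER — for `N_f = 2` exactly, for `N_f = 3` modulo ONE sign input at the scheme's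
own side and super-logarithmic volumes.

EVERYTHING OF THE LINE EXCEPT ITS CORE IS LANDED (all `--supports stmt-QuantumFields-17497`, namespace
`Summit.QuantumFields.QCD.Theorems.ChiralMobilityGapSketch`):
* wave 1 (stub-workers): `stub_slowChannel` p134470 (one slow channel kills the uniform gap, fixed `k`,
  `S = n → ∞`), `stub_pionSigned` p134616 (SIGNED pion-pair correlator `= −∫det D·X/∫det D`),
  `stub_momentCompare` p134985 (`fm(s)^{2/s} ≤ 144 E₊[Σ|G|²]` at degenerate tuples, `N_f ≥ 2`),
  `stub_detTwo` p135075 (`det D = |det D|` for a degenerate doublet), `stub_acrossK` p135210 (across-`k`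
  bookkeeping);
* lead: `stub_pinTwo` / `stub_pinThree` p135443 (`…ChiralMobilityGapPinOfLower.lean`: the two FIRST LEMMAS,
  definition-free — (iii) with vanishing rate ⇒ `reg.IsChiralAtZero`, `N_f = 2` exactly / `N_f = 3` modulo
  `Sign` on degenerate triples + super-log volumes + pion-weight sign coherence);
* lead: `…ChiralMobilityGapSketchDefs.lean` p135592 — the line's predicates `LowerWith`, `VanishingChiralRate`,
  `SuperLogVolume`, `pionWeight`, `PionWeightSignCoherent`, `MobilityGapPlus` (= `C⁺`), the glue
  `isChiralAtZero_two/_three`, `pinned_of_mobilityGapPlus`, the registered TRANSFER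
  `stub_transfer : MobilityGapPlus → ChiralMobilityGap`, and the honesty record
  `mobilityGap_of_mobilityGapPlus : MobilityGapPlus → MobilityGap`.
(The previous self-contained version of this skeleton, v3, with all statements inline, is superseded; its
stub texts are byte-identical to the landed ones.)

OPEN (the only `sorry` below): `stub_core : MobilityGapPlus` — it CONTAINS the support crux `MobilityGap`
(stmt-9150, open-problem: Cruxes/MobilityGap LEAD-c1…c8, three dead lines, necessary core `LawLightFree`
p116312 with no mechanism on file) verbatim, plus `VanishingChiralRate` (the (iii)-rate along degenerate
tuples is `o(1)` as `t → 0⁺`) and, for `N_f = 3`, `SuperLogVolume ∧ PionWeightSignCoherent`.  Lead's verdict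
(LEAD-c1.md): crux-sized ⇒ `promote-stub`.
-/

noncomputable section

namespace Summit.QuantumFields.QCD.Theorems.ChiralMobilityGapSketch

/-- STUB F — THE CORE (held by the lead; OPEN). `C⁺ = MobilityGapPlus`: the clause package of 9150 with
vanishing chiral rate (and, for `N_f = 3`, super-log volumes + pion-weight sign coherence).  It CONTAINS the
support `MobilityGap` (stmt-QuantumFields-9150, open-problem) verbatim — `mobilityGap_of_mobilityGapPlus`. -/
theorem stub_core : MobilityGapPlus := by
  sorry

/-- THE COMPOSITION: the crux BY NAME from the stubs — the landed transfer applied to the core stub. -/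
theorem ChiralMobilityGap_of : Summit.QuantumFields.QCD.Theses.WilsonMobilityGap.ChiralMobilityGap :=
  stub_transfer stub_core

end Summit.QuantumFields.QCD.Theorems.ChiralMobilityGapSketch

end
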